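import Mathlib
import Summits.AtomisticToContinuum.FouriersLaw.Theorems.EmbeddedDrudeMourreKineticConductivityFinite
import Summits.AtomisticToContinuum.FouriersLaw.Theorems.EmbeddedDrudeMourreMourreDissolutionOddParityFloor
import Literature.MathematicalPhysics.KineticTheory.ZeroWavenumberSpace
import HarnessLib

/-!
# Kinetic floor on the odd tower from the odd-sector gap — stub `stub_oddTowerFloor` of line `swap-odd-threshold-rigidity`
(crux `EmbeddedDrudeMourre.MourreDissolution`, item stmt-AtomisticToContinuum-12594; helper file, `--supports`)

Registered stub C of the checked skeleton of line `swap-odd-threshold-rigidity` (lead c7), in the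
skeleton's stub namespace `Summit.AtomisticToContinuum.FouriersLaw.Theorems.MourreDissolution`:
the parity floor (stub C-L, `stub_oddParityFloor`, taken here as the ANTECEDENT of the registered
signature) implies the kinetic floor on the odd tower. If ALS's collision form
`q = boltzmannForm ω₂ a b` (`ω₂ > 0`) has an odd-sector gap `g₀‖f‖² ≤ q(f)` (`f` odd, periodic, `L²`),
then with `g := 2π g₀`, for every number `m + 1` of legs and every globally odd, coordinatewise
`2π`-periodic, measurable, square-integrable `F` on the cell `(−π,π]^{m+1}`,
`g ∫ F² ≤ Σᵢ ∫ q(F(·ᵢ; k)) dk` (the form applied in leg `i`, the other legs frozen).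

Proof (all in `ℝ≥0∞`, on `Measure.pi (fun _ => volume.restrict (Ioc (-π) π))`, which is the cube
measure by `Measure.restrict_pi_pi`). For a leg `i` and frozen legs `k` the slice
`f(s) = F (update k i s)` is `2π`-periodic and measurable, so `q(f) ≥ q(f_odd)`
(`KineticConductivityFinite.boltzmannForm_oddPart_le`) `≥ g₀ ‖f_odd‖²` by the gap whenever
`‖f‖² < ∞`, which holds for a.e. `k` because `∫ ‖f‖² dk = 2π ∫ F² < ∞` (frozen-leg Tonelli,
`lintegral_lintegral_update`, proved with `MeasureTheory.lmarginal`). Integrating,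
`∫ q(F(·ᵢ; k)) dk ≥ g₀ ∫ ‖f_odd‖² dk = 2π g₀ ∫ ((F − F∘Rᵢ)/2)²`, `Rᵢ` the reflection of leg `i`, and
summing over `i` the antecedent parity floor `Σᵢ ∫ ((F − F∘Rᵢ)/2)² ≥ ∫ F²` concludes.
-/

noncomputable section

namespace Summit.AtomisticToContinuum.FouriersLaw.Theorems.MourreDissolution

open MeasureTheory Filter Set Function Topology
open scoped InnerProductSpace ENNReal
open Literature.MathematicalPhysics.KineticTheory
open Literature.MathematicalPhysics.KineticTheory.HeatConduction
open Literature.MathematicalPhysics.KineticTheory.PhononBoltzmann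
open Summit.AtomisticToContinuum.FouriersLaw.Theorems.KineticConductivityFinite

/-- Measurability in the frozen legs of the integral over one leg:
`k ↦ ∫⁻ s, H (update k i s) ∂μ` is measurable for measurable `H` (it is the marginal
`∫⋯∫⁻_{i}, H`). [folklore] -/
theorem measurable_lintegral_update {μ : Measure ℝ} [SigmaFinite μ] {n : ℕ} (i : Fin n)
    {H : (Fin n → ℝ) → ℝ≥0∞} (hH : Measurable H) :
    Measurable fun k : Fin n → ℝ => ∫⁻ s, H (update k i s) ∂μ := by
  have h := hH.lmarginal (fun _ : Fin n => μ) (s := ({i} : Finset (Fin n)))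
  rw [lmarginal_singleton] at h
  exact h

/-- **Frozen-leg Tonelli.** On the product `Measure.pi (fun _ : Fin n => μ)` of a σ-finite measure,
integrating `H` over the leg `i` with the other legs frozen and then over all legs counts the
frozen leg once more: `∫⁻ k, ∫⁻ s, H (update k i s) ∂μ ∂(pi μ) = μ univ * ∫⁻ H ∂(pi μ)`
(both sides have the same marginal `∫⋯∫⁻_{i}`). [folklore] -/
theorem lintegral_lintegral_update {μ : Measure ℝ} [SigmaFinite μ] {n : ℕ} (i : Fin n)
    {H : (Fin n → ℝ) → ℝ≥0∞} (hH : Measurable H) :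
    ∫⁻ k, ∫⁻ s, H (update k i s) ∂μ ∂(Measure.pi fun _ : Fin n => μ) =
      μ univ * ∫⁻ k, H k ∂(Measure.pi fun _ : Fin n => μ) := by
  have hg : Measurable fun k : Fin n → ℝ => μ univ * H k := hH.const_mul _
  rw [← lintegral_const_mul _ hH]
  refine lintegral_eq_of_lmarginal_eq {i} (measurable_lintegral_update i hH) hg ?_
  rw [lmarginal_singleton, lmarginal_singleton]
  funext x
  have hmu : Measurable fun s : ℝ => H (update x i s) := hH.comp (measurable_update x)
  simp only [update_idem]
  rw [lintegral_const, lintegral_const_mul _ hmu, mul_comm]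

/-- Frozen-leg Tonelli on the Brillouin cell, in the vocabulary of `cellNormSq`:
`∫⁻ k, ‖G(·ᵢ; k)‖² ∂(cell^{n}) = 2π ∫⁻ G² ∂(cell^{n})`. [folklore] -/
theorem lintegral_cellNormSq_update {n : ℕ} (i : Fin n) {G : (Fin n → ℝ) → ℝ}
    (hG : Measurable G) :
    ∫⁻ k, cellNormSq (fun s => G (update k i s))
        ∂(Measure.pi fun _ : Fin n => (volume : Measure ℝ).restrict (Ioc (-Real.pi) Real.pi)) =
      ENNReal.ofReal (2 * Real.pi) * ∫⁻ k, ENNReal.ofReal (G k ^ 2)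
        ∂(Measure.pi fun _ : Fin n => (volume : Measure ℝ).restrict (Ioc (-Real.pi) Real.pi)) := by
  have hG2 : Measurable fun k : Fin n → ℝ => ENNReal.ofReal (G k ^ 2) :=
    (hG.pow_const 2).ennreal_ofReal
  have h := lintegral_lintegral_update
    (μ := (volume : Measure ℝ).restrict (Ioc (-Real.pi) Real.pi)) i hG2
  rw [Measure.restrict_apply_univ, Real.volume_Ioc] at h
  rw [show (2 * Real.pi : ℝ) = Real.pi - -Real.pi by ring]
  exact h

/-- Measurability of `k ↦ ‖G(·ᵢ; k)‖²` in the frozen legs. [folklore] -/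
theorem measurable_cellNormSq_update {n : ℕ} (i : Fin n) {G : (Fin n → ℝ) → ℝ}
    (hG : Measurable G) :
    Measurable fun k : Fin n → ℝ => cellNormSq (fun s => G (update k i s)) :=
  measurable_lintegral_update (μ := (volume : Measure ℝ).restrict (Ioc (-Real.pi) Real.pi)) i
    ((hG.pow_const 2).ennreal_ofReal)

/-- **Tower floor on the product of cells.** If `g₀` is an odd-sector gap constant of
`q = boltzmannForm ω₂ a b` (`ω₂ > 0`), then for every coordinatewise `2π`-periodic measurable `F`
on `(−π,π]^n` with `∫ F² < ∞` and satisfying the parity floor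
`∫ F² ≤ Σᵢ ∫ ((F − F∘Rᵢ)/2)²`, one has `2π g₀ ∫ F² ≤ Σᵢ ∫ q(F(·ᵢ; k)) dk`. [folklore] -/
theorem towerFloor_pi {ω₂ a b g₀ : ℝ} (hω : 0 < ω₂)
    (hq : ∀ f : ℝ → ℝ, Function.Periodic f (2 * Real.pi) → Measurable f → Function.Odd f →
      cellNormSq f < ⊤ → ENNReal.ofReal g₀ * cellNormSq f ≤ boltzmannForm ω₂ a b f)
    {n : ℕ} {F : (Fin n → ℝ) → ℝ}
    (hper : ∀ (k : Fin n → ℝ) (i : Fin n), F (update k i (k i + 2 * Real.pi)) = F k)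
    (hF : Measurable F)
    (hfin : ∫⁻ k, ENNReal.ofReal (F k ^ 2)
      ∂(Measure.pi fun _ : Fin n => (volume : Measure ℝ).restrict (Ioc (-Real.pi) Real.pi)) < ⊤)
    (hL : ∫⁻ k, ENNReal.ofReal (F k ^ 2)
        ∂(Measure.pi fun _ : Fin n => (volume : Measure ℝ).restrict (Ioc (-Real.pi) Real.pi)) ≤
      ∑ i : Fin n, ∫⁻ k, ENNReal.ofReal (((F k - F (update k i (-k i))) / 2) ^ 2)
        ∂(Measure.pi fun _ : Fin n => (volume : Measure ℝ).restrict (Ioc (-Real.pi) Real.pi))) :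
    ENNReal.ofReal (2 * Real.pi * g₀) * ∫⁻ k, ENNReal.ofReal (F k ^ 2)
        ∂(Measure.pi fun _ : Fin n => (volume : Measure ℝ).restrict (Ioc (-Real.pi) Real.pi)) ≤
      ∑ i : Fin n, ∫⁻ k, boltzmannForm ω₂ a b (fun s => F (update k i s))
        ∂(Measure.pi fun _ : Fin n => (volume : Measure ℝ).restrict (Ioc (-Real.pi) Real.pi)) := by
  set P : Measure (Fin n → ℝ) :=
    Measure.pi fun _ : Fin n => (volume : Measure ℝ).restrict (Ioc (-Real.pi) Real.pi) with hP
  -- (1) slice by slice: `q(slice) ≥ q(odd part) ≥ g₀ ‖odd part‖²` for square-integrable slices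
  have hpt : ∀ (i : Fin n) (k : Fin n → ℝ), cellNormSq (fun s => F (update k i s)) < ⊤ →
      ENNReal.ofReal g₀ * cellNormSq (fun s => (F (update k i s) - F (update k i (-s))) / 2) ≤
        boltzmannForm ω₂ a b (fun s => F (update k i s)) := by
    intro i k hk
    have hperf : Function.Periodic (fun s => F (update k i s)) (2 * Real.pi) := by
      intro s
      have h := hper (update k i s) i
      simp only [update_idem, update_self] at h
      exact h
    have hmeasf : Measurable (fun s => F (update k i s)) := hF.comp (measurable_update k)
    have hmeaso : Measurable (fun s => (F (update k i s) - F (update k i (-s))) / 2) :=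
      (hmeasf.sub (hmeasf.comp measurable_neg)).div_const 2
    have hoddo : Function.Odd (fun s => (F (update k i s) - F (update k i (-s))) / 2) := by
      intro s
      simp only [neg_neg]
      ring
    have hfino : cellNormSq (fun s => (F (update k i s) - F (update k i (-s))) / 2) < ⊤ :=
      (cellNormSq_oddPart_le hmeasf).trans_lt hk
    calc ENNReal.ofReal g₀ * cellNormSq (fun s => (F (update k i s) - F (update k i (-s))) / 2)
        ≤ boltzmannForm ω₂ a b (fun s => (F (update k i s) - F (update k i (-s))) / 2) :=
          hq _ (oddPart_periodic hperf) hmeaso hoddo hfino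
      _ ≤ boltzmannForm ω₂ a b (fun s => F (update k i s)) :=
          boltzmannForm_oddPart_le hω a b hperf hmeasf
  -- (2) measurability of the reflected differences
  have hRm : ∀ i : Fin n, Measurable fun k : Fin n → ℝ => update k i (-k i) := fun i =>
    (measurePreserving_update_neg measurePreserving_neg_volume_restrict_Ioc i).measurable
  have hPm : ∀ i : Fin n, Measurable fun k : Fin n → ℝ => (F k - F (update k i (-k i))) / 2 :=
    fun i => (hF.sub (hF.comp (hRm i))).div_const 2
  -- (3) a.e. slice is square integrable: `∫ ‖slice‖² dk = 2π ∫ F² < ∞`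
  have hae : ∀ i : Fin n, ∀ᵐ k ∂P, cellNormSq (fun s => F (update k i s)) < ⊤ := by
    intro i
    refine ae_lt_top (measurable_cellNormSq_update i hF) ?_
    have h := lintegral_cellNormSq_update i hF
    rw [← hP] at h
    rw [h]
    exact ENNReal.mul_ne_top ENNReal.ofReal_ne_top hfin.ne
  -- (4) leg by leg: `g₀ · 2π ∫ ((F − F∘Rᵢ)/2)² = ∫ g₀ ‖odd partᵢ‖² dk ≤ ∫ q(sliceᵢ) dk`
  have hstep : ∀ i : Fin n,
      ENNReal.ofReal g₀ * (ENNReal.ofReal (2 * Real.pi) *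
          ∫⁻ k, ENNReal.ofReal (((F k - F (update k i (-k i))) / 2) ^ 2) ∂P) ≤
        ∫⁻ k, boltzmannForm ω₂ a b (fun s => F (update k i s)) ∂P := by
    intro i
    have h := lintegral_cellNormSq_update i (hPm i)
    rw [← hP] at h
    simp only [update_idem, update_self] at h
    rw [← h, ← lintegral_const_mul' _ _ ENNReal.ofReal_ne_top]
    apply lintegral_mono_ae
    filter_upwards [hae i] with k hk
    exact hpt i k hk
  -- (5) sum over the legs and use the parity floor
  calc ENNReal.ofReal (2 * Real.pi * g₀) * ∫⁻ k, ENNReal.ofReal (F k ^ 2) ∂P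
      = ENNReal.ofReal g₀ * (ENNReal.ofReal (2 * Real.pi) * ∫⁻ k, ENNReal.ofReal (F k ^ 2) ∂P) := by
        rw [ENNReal.ofReal_mul (by positivity : (0 : ℝ) ≤ 2 * Real.pi)]
        ring
    _ ≤ ENNReal.ofReal g₀ * (ENNReal.ofReal (2 * Real.pi) *
          ∑ i : Fin n, ∫⁻ k, ENNReal.ofReal (((F k - F (update k i (-k i))) / 2) ^ 2) ∂P) := by
        gcongr
    _ = ∑ i : Fin n, ENNReal.ofReal g₀ * (ENNReal.ofReal (2 * Real.pi) *
          ∫⁻ k, ENNReal.ofReal (((F k - F (update k i (-k i))) / 2) ^ 2) ∂P) := by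
        rw [Finset.mul_sum, Finset.mul_sum]
    _ ≤ ∑ i : Fin n, ∫⁻ k, boltzmannForm ω₂ a b (fun s => F (update k i s)) ∂P :=
        Finset.sum_le_sum fun i _ => hstep i

/-- **Stub C of line `swap-odd-threshold-rigidity` (`stub_oddTowerFloor`): the parity floor implies
the kinetic floor on the odd tower, uniformly in the number of legs.**
Assuming the parity floor `∫ F² ≤ Σᵢ ∫ ((F − F∘Rᵢ)/2)²` for globally odd measurable `F`
(stub C-L, `stub_oddParityFloor`), an odd-sector gap of `q = boltzmannForm ω₂ a b` (`ω₂ > 0`)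
yields `g > 0` (namely `2π ×` the gap constant) with `g ∫_{cell^{m+1}} F² ≤ Σᵢ ∫_{cell^{m+1}} q(F(·ᵢ; k)) dk`
for every globally odd, coordinatewise `2π`-periodic, measurable, square-integrable `F`.
Specialisation of `towerFloor_pi` to the cube via `Measure.restrict_pi_pi`. [folklore] -/
theorem stub_oddTowerFloor :
    (∀ (m : ℕ) (F : (Fin (m + 1) → ℝ) → ℝ), (∀ k, F (-k) = -F k) → Measurable F →
        (∫⁻ k in Set.pi Set.univ (fun _ : Fin (m + 1) => Set.Ioc (-Real.pi) Real.pi),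
            ENNReal.ofReal (F k ^ 2)) ≤
          ∑ i : Fin (m + 1),
            ∫⁻ k in Set.pi Set.univ (fun _ : Fin (m + 1) => Set.Ioc (-Real.pi) Real.pi),
              ENNReal.ofReal (((F k - F (Function.update k i (-k i))) / 2) ^ 2)) → (∀ ω₂ a b : ℝ, 0 < ω₂ → HasOddSectorGap ω₂ a b → ∃ g : ℝ, 0 < g ∧
        ∀ (m : ℕ) (F : (Fin (m + 1) → ℝ) → ℝ),
          (∀ k, F (-k) = -F k) →
          (∀ (k : Fin (m + 1) → ℝ) (i : Fin (m + 1)), F (Function.update k i (k i + 2 * Real.pi)) = F k) →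
          Measurable F →
          (∫⁻ k in Set.pi Set.univ (fun _ : Fin (m + 1) => Set.Ioc (-Real.pi) Real.pi),
              ENNReal.ofReal (F k ^ 2)) < ⊤ →
          ENNReal.ofReal g *
              (∫⁻ k in Set.pi Set.univ (fun _ : Fin (m + 1) => Set.Ioc (-Real.pi) Real.pi),
                ENNReal.ofReal (F k ^ 2)) ≤
            ∑ i : Fin (m + 1),
              ∫⁻ k in Set.pi Set.univ (fun _ : Fin (m + 1) => Set.Ioc (-Real.pi) Real.pi),
                boltzmannForm ω₂ a b (fun s => F (Function.update k i s))) := by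
  intro hL ω₂ a b hω hgap
  obtain ⟨g₀, hg₀, hq⟩ := hgap
  refine ⟨2 * Real.pi * g₀, by positivity, ?_⟩
  intro m F hodd hper hF hfin
  have hL' := hL m F hodd hF
  have hcube : (volume : Measure (Fin (m + 1) → ℝ)).restrict
      (Set.pi Set.univ fun _ : Fin (m + 1) => Set.Ioc (-Real.pi) Real.pi) =
        Measure.pi fun _ : Fin (m + 1) =>
          (volume : Measure ℝ).restrict (Set.Ioc (-Real.pi) Real.pi) := by
    rw [volume_pi]
    exact Measure.restrict_pi_pi _ _
  rw [hcube] at hfin hL' ⊢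
  exact towerFloor_pi hω hq hper hF hfin hL'

end Summit.AtomisticToContinuum.FouriersLaw.Theorems.MourreDissolution

end
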